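import Summits.AtomisticToContinuum.FouriersLaw.Theses.HonestZwanzig

/-!
# Sketch — crux-ideate stmt-AtomisticToContinuum-12693 (HonestZwanzig.OrthogonalOhm), round 1, ideator 3

First-lemma signatures of the two crux idea cards filed by this seat, all elaborating over existing
declarations (`pinnedChain`, `OscillatorChain.gibbsMeasure`, `.transitionKernel`, `.generator`, `.bondCurrent`,
Mathlib `condExp`, `fderiv`, `Matrix.inv`), with the `let`-prefix byte-identical to the crux decl; plus

* card A (`conditional-zwanzig-bare-memory`): the parity half of its first lemma PROVED
  (`integral_even_mul_bondCurrent_gibbs`, `thetaEvenOrthogonalCurrents_holds`);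
* card B (`regression-ward-identity`): the typed transfer `C⁺ ⇒ C` PROVED —
  `orthogonalOhm_of : RegressionIdentity → BulkRegressionOhm → ClampedContactDecay → ContactResponses →
   HonestZwanzig.OrthogonalOhm` (axioms propext / Classical.choice / Quot.sound).

`lean check` rc 0, 0 sorries.
-/

namespace Summit.AtomisticToContinuum.FouriersLaw.Cruxes.OrthogonalOhm.Ideator3

open MeasureTheory Filter Topology

/-! ### Card A — conditional-zwanzig-bare-memory -/

/-- First lemma of card A, elementary half (PARITY KILLS THE EULER BLOCK ON *ALL* PROFILE
FUNCTIONALS): under the Gibbs measure every momentum-reversal-invariant observable `F` is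
orthogonal to every bond current. With `F = φ(e_0,…,e_{N-1}) · ψ'(e)`-type profile functionals this
is the statement that the compression of the Liouvillian to `L²(σ(e)) ⊖ span{1,ẽ_x}` has no
first-order (Euler) part. -/
def ThetaEvenOrthogonalCurrents : Prop :=
  ∀ ω₂ lam β γ : ℝ, 0 < ω₂ → 0 < lam → 0 < β → 0 < γ → ∀ T : ℝ, 0 < T → ∀ N : ℕ,
    let P := Literature.MathematicalPhysics.KineticTheory.HeatConduction.pinnedChain ω₂ lam β γ
    let X := Literature.MathematicalPhysics.KineticTheory.HeatConduction.PhaseSpace N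
    let μ : Measure X := P.gibbsMeasure N T
    ∀ F : X → ℝ, (∀ z : X, F (z.1, -z.2) = F z) →
      ∀ b : Fin N, Integrable (fun z => F z * P.bondCurrent N b z) μ →
        ∫ z, F z * P.bondCurrent N b z ∂μ = 0

/-- First lemma of card A, conditional-expectation form: the bond currents have ZERO conditional
expectation given the site-energy profile `e = (e_x)_x` (the σ-algebra pulled back along the
profile map), i.e. every current lies in the range of the nonlinear Zwanzig projection
`𝐐 = 1 − E[· | σ(e)]`. -/
def CondExpCurrentGivenProfile : Prop :=
  ∀ ω₂ lam β γ : ℝ, 0 < ω₂ → 0 < lam → 0 < β → 0 < γ → ∀ T : ℝ, 0 < T → ∀ N : ℕ,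
    let P := Literature.MathematicalPhysics.KineticTheory.HeatConduction.pinnedChain ω₂ lam β γ
    let X := Literature.MathematicalPhysics.KineticTheory.HeatConduction.PhaseSpace N
    let μ : Measure X := P.gibbsMeasure N T
    let e : Fin N → X → ℝ := fun x z => z.2 x ^ 2 / 2 + P.U (z.1 x) +
      ∑ j : Fin N, ((if j.val = x.val + 1 then P.V (z.1 j - z.1 x) / 2 else 0) +
        (if x.val = j.val + 1 then P.V (z.1 x - z.1 j) / 2 else 0))
    let prof : X → (Fin N → ℝ) := fun z x => e x z
    let mₑ : MeasurableSpace X := MeasurableSpace.comap prof inferInstance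
    ∀ b : Fin N, μ[P.bondCurrent N b | mₑ] =ᵐ[μ] 0

/-- First lemma of card A, generator form (the profile-functional block of the thermostatted
Liouvillian is a pure CONTACT operator): for smooth profile functionals `φ, ψ : ℝ^N → ℝ`,
`∫ φ(e) · L(ψ ∘ e) dμ` contains no bulk term — only the two bath sites contribute, through
`γ[(T − p_x²) ∂_xψ + T p_x² ∂_x²ψ]`, `x ∈ {0, N−1}`. -/
def ProfileBlockIsContact : Prop :=
  ∀ ω₂ lam β γ : ℝ, 0 < ω₂ → 0 < lam → 0 < β → 0 < γ → ∀ T : ℝ, 0 < T → ∀ N : ℕ, 2 ≤ N →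
    let P := Literature.MathematicalPhysics.KineticTheory.HeatConduction.pinnedChain ω₂ lam β γ
    let X := Literature.MathematicalPhysics.KineticTheory.HeatConduction.PhaseSpace N
    let μ : Measure X := P.gibbsMeasure N T
    let e : Fin N → X → ℝ := fun x z => z.2 x ^ 2 / 2 + P.U (z.1 x) +
      ∑ j : Fin N, ((if j.val = x.val + 1 then P.V (z.1 j - z.1 x) / 2 else 0) +
        (if x.val = j.val + 1 then P.V (z.1 x - z.1 j) / 2 else 0))
    let prof : X → (Fin N → ℝ) := fun z x => e x z
    ∀ φ ψ : (Fin N → ℝ) → ℝ, ContDiff ℝ 2 φ → ContDiff ℝ 2 ψ →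
      HasCompactSupport φ → HasCompactSupport ψ →
      ∫ z, φ (prof z) * P.generator N T T (ψ ∘ prof) z ∂μ =
        P.γ * ∑ x : Fin N, (if x.val = 0 ∨ x.val = N - 1 then
          ∫ z, φ (prof z) * ((T - z.2 x ^ 2) * fderiv ℝ ψ (prof z) (Pi.single x 1) +
            T * z.2 x ^ 2 * fderiv ℝ (fun v => fderiv ℝ ψ v (Pi.single x 1)) (prof z) (Pi.single x 1)) ∂μ
          else 0)

/-- Card A, first lemma (elementary half), PROVED: every momentum-reversal-even observable is orthogonal to
every bond current under the Gibbs measure of `pinnedChain` — parity kills the Euler block on ALL profile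
functionals (take `F = φ(e)·∂ψ(e)`). No integrability hypothesis is needed (Bochner junk is symmetric). -/
theorem integral_even_mul_bondCurrent_gibbs (ω₂ lam β γ T : ℝ) (N : ℕ)
    (F : Literature.MathematicalPhysics.KineticTheory.HeatConduction.PhaseSpace N → ℝ)
    (hF : ∀ z, F (z.1, -z.2) = F z) (b : Fin N) :
    ∫ z, F z * (Literature.MathematicalPhysics.KineticTheory.HeatConduction.pinnedChain ω₂ lam β γ).bondCurrent N b z
      ∂((Literature.MathematicalPhysics.KineticTheory.HeatConduction.pinnedChain ω₂ lam β γ).gibbsMeasure N T) = 0 := by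
  set P := Literature.MathematicalPhysics.KineticTheory.HeatConduction.pinnedChain ω₂ lam β γ with hP
  rw [P.integral_gibbsMeasure]
  have h := Literature.MathematicalPhysics.KineticTheory.HeatConduction.integral_comp_momentumReversal N
    fun x => F x * P.bondCurrent N b x * P.gibbsDensity N T x
  simp only [hF, Literature.MathematicalPhysics.KineticTheory.HeatConduction.OscillatorChain.bondCurrent_neg_momentum,
    Literature.MathematicalPhysics.KineticTheory.HeatConduction.OscillatorChain.gibbsDensity,
    Literature.MathematicalPhysics.KineticTheory.HeatConduction.OscillatorChain.hamiltonian_neg_momentum,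
    mul_neg, neg_mul, integral_neg] at h
  have h0 : ∫ x, F x * P.bondCurrent N b x * P.gibbsDensity N T x = 0 := by
    simp only [Literature.MathematicalPhysics.KineticTheory.HeatConduction.OscillatorChain.gibbsDensity]
    linarith
  rw [h0, mul_zero]

/-- The Prop `ThetaEvenOrthogonalCurrents` above, DISCHARGED. -/
theorem thetaEvenOrthogonalCurrents_holds : ThetaEvenOrthogonalCurrents := by
  intro ω₂ lam β γ _ _ _ _ T _ N P X μ F hF b _
  exact integral_even_mul_bondCurrent_gibbs ω₂ lam β γ T N F hF b

/-! ### Card B — regression-ward-identity -/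

/-- (R1) EXACT REGRESSION IDENTITY at every `s > 0`, fixed `N`, free origin `a`:
`schur_s(j_b, J) = reg_s(b; a) − a·γ·schur_s(j_b, p_0²) + (N−1−a)·γ·schur_s(j_b, p²_{N−1})`, where
`reg_s(b;a) = Σ_{x,y,z} lap_s(j_b,e_x) (G(s)⁻¹)_{xy} cov(e_y,e_z) (z − a)` is the Laplace-space regression of the
bond current on the energy profile, paired with the linear profile centred at `a`.  Fixed-`N` content only
(Kolmogorov identity `s·lap_s(f,e_x) − cov(f,e_x) = lap_s(f,Le_x)`, `J = L X_a + a b_0 − (N−1−a) b_{N−1}`,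
parity `cov(j_b, X_a) = 0`, linearity of `lap` in the second slot on admissible observables). -/
def RegressionIdentity : Prop :=
  ∀ ω₂ lam β γ : ℝ, 0 < ω₂ → 0 < lam → 0 < β → 0 < γ → ∀ T : ℝ, 0 < T → ∀ N : ℕ, ∀ hN : 2 ≤ N, let P := Literature.MathematicalPhysics.KineticTheory.HeatConduction.pinnedChain ω₂ lam β γ; let X := Literature.MathematicalPhysics.KineticTheory.HeatConduction.PhaseSpace N; let μ : MeasureTheory.Measure X := P.gibbsMeasure N T; let corr : (X → ℝ) → (X → ℝ) → ℝ → ℝ := fun f g t => (∫ z, f z * (∫ y, g y ∂(P.transitionKernel N T T t.toNNReal z)) ∂μ) - (∫ z, f z ∂μ) * (∫ z, g z ∂μ); let lap : ℝ → (X → ℝ) → (X → ℝ) → ℝ := fun s f g => ∫ t in Set.Ioi (0 : ℝ), Real.exp (-(s * t)) * corr f g t; let e : Fin N → X → ℝ := fun x z => z.2 x ^ 2 / 2 + P.U (z.1 x) + ∑ j : Fin N, ((if j.val = x.val + 1 then P.V (z.1 j - z.1 x) / 2 else 0) + (if x.val = j.val + 1 then P.V (z.1 x - z.1 j) / 2 else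 0)); let G : ℝ → Matrix (Fin N) (Fin N) ℝ := fun s => Matrix.of fun x y => lap s (e x) (e y); let schur : ℝ → (X → ℝ) → (X → ℝ) → ℝ := fun s f g => lap s f g - ∑ x : Fin N, ∑ y : Fin N, lap s f (e x) * (G s)⁻¹ x y * lap s (e y) g; let J : X → ℝ := fun z => ∑ i : Fin N, P.bondCurrent N i z; let cov : (X → ℝ) → (X → ℝ) → ℝ := fun f g => (∫ z, f z * g z ∂μ) - (∫ z, f z ∂μ) * (∫ z, g z ∂μ); let reg : ℝ → Fin N → ℝ → ℝ := fun s b a => ∑ x : Fin N, ∑ y : Fin N, ∑ z : Fin N, lap s (P.bondCurrent N b) (e x) * (G s)⁻¹ x y * cov (e y) (e z) * ((z.val : ℝ) - a); ∀ s : ℝ, 0 < s → ∀ b : Fin N, ∀ a : ℝ,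
      schur s (P.bondCurrent N b) J =
        reg s b a - a * P.γ * schur s (P.bondCurrent N b) (fun w => w.2 ⟨0, by omega⟩ ^ 2) +
          (((N : ℝ) - 1) - a) * P.γ * schur s (P.bondCurrent N b) (fun w => w.2 ⟨N - 1, by omega⟩ ^ 2)

/-- (R2) BULK REGRESSION OHM LAW (the even-sector core): the regression term centred at the bond itself,
`reg_s(b; b)`, has a DC limit `r_b`, bounded uniformly in `N`, equal to one constant `k` up to `ε` in the bulk. -/
def BulkRegressionOhm : Prop :=
  ∀ ω₂ lam β γ : ℝ, 0 < ω₂ → 0 < lam → 0 < β → 0 < γ → ∀ T : ℝ, 0 < T → ∃ k C : ℝ, ∀ ε : ℝ, 0 < ε → ∃ R : ℕ, ∀ N : ℕ, ∀ hN : 2 ≤ N, let P := Literature.MathematicalPhysics.KineticTheory.HeatConduction.pinnedChain ω₂ lam β γ; let X := Literature.MathematicalPhysics.KineticTheory.HeatConduction.PhaseSpace N; let μ : MeasureTheory.Measure X := P.gibbsMeasure N T; let corr : (X → ℝ) → (X → ℝ) → ℝ → ℝ := fun f g t => (∫ z, f z * (∫ y, g y ∂(P.transitionKernel N T T t.toNNReal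 z)) ∂μ) - (∫ z, f z ∂μ) * (∫ z, g z ∂μ); let lap : ℝ → (X → ℝ) → (X → ℝ) → ℝ := fun s f g => ∫ t in Set.Ioi (0 : ℝ), Real.exp (-(s * t)) * corr f g t; let e : Fin N → X → ℝ := fun x z => z.2 x ^ 2 / 2 + P.U (z.1 x) + ∑ j : Fin N, ((if j.val = x.val + 1 then P.V (z.1 j - z.1 x) / 2 else 0) + (if x.val = j.val + 1 then P.V (z.1 x - z.1 j) / 2 else 0)); let G : ℝ → Matrix (Fin N) (Fin N) ℝ := fun s => Matrix.of fun x y => lap s (e x) (e y); let schur : ℝ → (X → ℝ) → (X → ℝ) → ℝ := fun s f g => lap s f g - ∑ x : Fin N, ∑ y : Fin N, lap s f (e x) * (G s)⁻¹ x y * lap s (e y) g; let J : X → ℝ := fun z => ∑ i : Fin N, P.bondCurrent N i z; let cov : (X → ℝ) → (X → ℝ) → ℝ := fun f g => (∫ z, f z * g z ∂μ) - (∫ z, f z ∂μ) * (∫ z, g z ∂μ); let reg : ℝ → Fin N → ℝ → ℝ := fun s b a => ∑ x : Fin N, ∑ y : Fin N, ∑ z : Fin N, lap s (P.bondCurrent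 N b) (e x) * (G s)⁻¹ x y * cov (e y) (e z) * ((z.val : ℝ) - a); ∀ b : Fin N, b.val + 1 < N → ∃ r : ℝ,
      Filter.Tendsto (fun s => reg s b (b.val : ℝ)) (nhdsWithin (0 : ℝ) (Set.Ioi 0)) (nhds r) ∧ |r| ≤ C ∧
        (R ≤ b.val → b.val + 2 + R ≤ N → |r - k| ≤ ε)

/-- (R3) CLAMPED CONTACT DECAY (bond-resolved contact responses): the clamped DC responses of the two contact
kinetic temperatures to the current at bond `b` exist and are small at distance: `dist·|ω| ≤ C` always and
`≤ ε` beyond distance `R` (e.g. exponential clamped locality). -/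
def ClampedContactDecay : Prop :=
  ∀ ω₂ lam β γ : ℝ, 0 < ω₂ → 0 < lam → 0 < β → 0 < γ → ∀ T : ℝ, 0 < T → ∃ C : ℝ, ∀ ε : ℝ, 0 < ε → ∃ R : ℕ, ∀ N : ℕ, ∀ hN : 2 ≤ N, let P := Literature.MathematicalPhysics.KineticTheory.HeatConduction.pinnedChain ω₂ lam β γ; let X := Literature.MathematicalPhysics.KineticTheory.HeatConduction.PhaseSpace N; let μ : MeasureTheory.Measure X := P.gibbsMeasure N T; let corr : (X → ℝ) → (X → ℝ) → ℝ → ℝ := fun f g t => (∫ z, f z * (∫ y, g y ∂(P.transitionKernel N T T t.toNNReal z)) ∂μ) - (∫ z, f z ∂μ) * (∫ z, g z ∂μ); let lap : ℝ → (X → ℝ) → (X → ℝ) → ℝ := fun s f g => ∫ t in Set.Ioi (0 : ℝ), Real.exp (-(s * t)) * corr f g t; let e : Fin N → X → ℝ := fun x z => z.2 x ^ 2 / 2 + P.U (z.1 x) + ∑ j : Fin N, ((if j.val = x.val + 1 then P.V (z.1 j - z.1 x) / 2 else 0) + (if x.val = j.val + 1 then P.V (z.1 x - z.1 j) / 2 else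 0)); let G : ℝ → Matrix (Fin N) (Fin N) ℝ := fun s => Matrix.of fun x y => lap s (e x) (e y); let schur : ℝ → (X → ℝ) → (X → ℝ) → ℝ := fun s f g => lap s f g - ∑ x : Fin N, ∑ y : Fin N, lap s f (e x) * (G s)⁻¹ x y * lap s (e y) g; let J : X → ℝ := fun z => ∑ i : Fin N, P.bondCurrent N i z; ∀ b : Fin N, b.val + 1 < N → ∃ ω₀ ω₁ : ℝ,
      Filter.Tendsto (fun s => schur s (P.bondCurrent N b) (fun w => w.2 ⟨0, by omega⟩ ^ 2))
          (nhdsWithin (0 : ℝ) (Set.Ioi 0)) (nhds ω₀) ∧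
        Filter.Tendsto (fun s => schur s (P.bondCurrent N b) (fun w => w.2 ⟨N - 1, by omega⟩ ^ 2))
          (nhdsWithin (0 : ℝ) (Set.Ioi 0)) (nhds ω₁) ∧
        (b.val : ℝ) * |ω₀| ≤ C ∧ (((N : ℝ) - 1) - b.val) * |ω₁| ≤ C ∧
        (R ≤ b.val → (b.val : ℝ) * |ω₀| ≤ ε) ∧ (b.val + 2 + R ≤ N → (((N : ℝ) - 1) - b.val) * |ω₁| ≤ ε)

/-- (R4) CONTACT RESPONSES — the crux's own second conjunct, verbatim. -/
def ContactResponses : Prop :=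
  ∀ ω₂ lam β γ : ℝ, 0 < ω₂ → 0 < lam → 0 < β → 0 < γ → ∀ T : ℝ, 0 < T → ∃ C : ℝ, ∀ N : ℕ, 2 ≤ N → let P := Literature.MathematicalPhysics.KineticTheory.HeatConduction.pinnedChain ω₂ lam β γ; let X := Literature.MathematicalPhysics.KineticTheory.HeatConduction.PhaseSpace N; let μ : MeasureTheory.Measure X := P.gibbsMeasure N T; let corr : (X → ℝ) → (X → ℝ) → ℝ → ℝ := fun f g t => (∫ z, f z * (∫ y, g y ∂(P.transitionKernel N T T t.toNNReal z)) ∂μ) - (∫ z, f z ∂μ) * (∫ z, g z ∂μ); let lap : ℝ → (X → ℝ) → (X → ℝ) → ℝ := fun s f g => ∫ t in Set.Ioi (0 : ℝ), Real.exp (-(s * t)) * corr f g t; let e : Fin N → X → ℝ := fun x z => z.2 x ^ 2 / 2 + P.U (z.1 x) + ∑ j : Fin N, ((if j.val = x.val + 1 then P.V (z.1 j - z.1 x) / 2 else 0) + (if x.val = j.val + 1 then P.V (z.1 x - z.1 j) / 2 else 0)); let G : ℝ → Matrix (Fin N) (Fin N) ℝ := fun s => Matrix.of fun x y => lap s (e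 x) (e y); let schur : ℝ → (X → ℝ) → (X → ℝ) → ℝ := fun s f g => lap s f g - ∑ x : Fin N, ∑ y : Fin N, lap s f (e x) * (G s)⁻¹ x y * lap s (e y) g; let J : X → ℝ := fun z => ∑ i : Fin N, P.bondCurrent N i z; ∀ b : Fin N, (b.val = 0 ∨ b.val = N - 1) → ∃ w : ℝ,
      Filter.Tendsto (fun s => schur s (fun z => z.2 b ^ 2) J) (nhdsWithin (0 : ℝ) (Set.Ioi 0)) (nhds w) ∧ |w| ≤ C

/-- TRANSFER `C⁺ ⇒ C`: the four statements above imply the crux `HonestZwanzig.OrthogonalOhm` BY NAME. -/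
theorem orthogonalOhm_of (h1 : RegressionIdentity) (h2 : BulkRegressionOhm) (h3 : ClampedContactDecay)
    (h4 : ContactResponses) :
    Summit.AtomisticToContinuum.FouriersLaw.Theses.HonestZwanzig.OrthogonalOhm := by
  intro ω₂ lam β γ hω hl hβ hγ T hT
  obtain ⟨k, C₂, hk⟩ := h2 ω₂ lam β γ hω hl hβ hγ T hT
  obtain ⟨C₃, hC₃⟩ := h3 ω₂ lam β γ hω hl hβ hγ T hT
  obtain ⟨C₄, hC₄⟩ := h4 ω₂ lam β γ hω hl hβ hγ T hT
  refine ⟨k, max (C₂ + γ * C₃ + γ * C₃) C₄, fun ε hε => ?_⟩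
  obtain ⟨R₂, hR₂⟩ := hk (ε / 3) (by positivity)
  obtain ⟨R₃, hR₃⟩ := hC₃ (ε / (3 * γ)) (by positivity)
  refine ⟨max R₂ R₃, fun N hN => ?_⟩
  intro P X μ corr lap e G schur J
  refine ⟨fun b hb => ?_, fun b hb => ?_⟩
  · -- bulk/bond clause
    obtain ⟨r, hr, hrC, hrk⟩ := hR₂ N hN b hb
    obtain ⟨ω₀, ω₁, hω₀, hω₁, hb₀, hb₁, hε₀, hε₁⟩ := hR₃ N hN b hb
    have hid := fun s (hs : 0 < s) => h1 ω₂ lam β γ hω hl hβ hγ T hT N hN s hs b (b.val : ℝ)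
    refine ⟨r - (b.val : ℝ) * γ * ω₀ + (((N : ℝ) - 1) - b.val) * γ * ω₁, ?_, ?_, ?_⟩
    · have hlim : Filter.Tendsto
          (fun s => (∑ x : Fin N, ∑ y : Fin N, ∑ z : Fin N,
              lap s (P.bondCurrent N b) (e x) * (G s)⁻¹ x y *
                (((∫ w, e y w * e z w ∂μ) - (∫ w, e y w ∂μ) * (∫ w, e z w ∂μ))) * ((z.val : ℝ) - (b.val : ℝ)))
            - (b.val : ℝ) * P.γ * schur s (P.bondCurrent N b) (fun w => w.2 ⟨0, by omega⟩ ^ 2)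
            + (((N : ℝ) - 1) - (b.val : ℝ)) * P.γ *
                schur s (P.bondCurrent N b) (fun w => w.2 ⟨N - 1, by omega⟩ ^ 2))
          (nhdsWithin (0 : ℝ) (Set.Ioi 0))
          (nhds (r - (b.val : ℝ) * γ * ω₀ + (((N : ℝ) - 1) - b.val) * γ * ω₁)) := by
        have hγP : P.γ = γ := rfl
        rw [hγP]
        exact (hr.sub (hω₀.const_mul _)).add (hω₁.const_mul _)
      refine hlim.congr' ?_
      filter_upwards [self_mem_nhdsWithin] with s hs
      exact (hid s hs).symm
    · refine le_trans ?_ (le_max_left _ _)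
      have h0 : |(b.val : ℝ) * γ * ω₀| ≤ γ * C₃ := by
        rw [abs_mul, abs_mul, abs_of_nonneg (Nat.cast_nonneg _), abs_of_pos hγ]
        nlinarith [hb₀, abs_nonneg ω₀]
      have h1' : |(((N : ℝ) - 1) - b.val) * γ * ω₁| ≤ γ * C₃ := by
        have hNb : 0 ≤ ((N : ℝ) - 1) - b.val := by
          have : (b.val : ℝ) + 1 ≤ N := by exact_mod_cast hb.le
          linarith
        rw [abs_mul, abs_mul, abs_of_nonneg hNb, abs_of_pos hγ]
        nlinarith [hb₁, abs_nonneg ω₁]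
      calc |r - (b.val : ℝ) * γ * ω₀ + (((N : ℝ) - 1) - b.val) * γ * ω₁|
          ≤ |r - (b.val : ℝ) * γ * ω₀| + |(((N : ℝ) - 1) - b.val) * γ * ω₁| := abs_add_le _ _
        _ ≤ |r| + |(b.val : ℝ) * γ * ω₀| + |(((N : ℝ) - 1) - b.val) * γ * ω₁| := by
            gcongr; exact abs_sub _ _
        _ ≤ C₂ + γ * C₃ + γ * C₃ := by gcongr
    · intro hRb hbR
      have hR₂b : R₂ ≤ b.val := le_trans (le_max_left _ _) hRb
      have hbR₂ : b.val + 2 + R₂ ≤ N := by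
        have := le_max_left R₂ R₃; omega
      have hR₃b : R₃ ≤ b.val := le_trans (le_max_right _ _) hRb
      have hbR₃ : b.val + 2 + R₃ ≤ N := by
        have := le_max_right R₂ R₃; omega
      have e1 : |r - k| ≤ ε / 3 := hrk hR₂b hbR₂
      have e2 : (b.val : ℝ) * |ω₀| ≤ ε / (3 * γ) := hε₀ hR₃b
      have e3 : (((N : ℝ) - 1) - b.val) * |ω₁| ≤ ε / (3 * γ) := hε₁ hbR₃
      have hNb : 0 ≤ ((N : ℝ) - 1) - b.val := by
        have : (b.val : ℝ) + 1 ≤ N := by exact_mod_cast hb.le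
        linarith
      have f2 : |(b.val : ℝ) * γ * ω₀| ≤ ε / 3 := by
        rw [abs_mul, abs_mul, abs_of_nonneg (Nat.cast_nonneg _), abs_of_pos hγ]
        have : γ * ((b.val : ℝ) * |ω₀|) ≤ γ * (ε / (3 * γ)) := by gcongr
        calc (b.val : ℝ) * γ * |ω₀| = γ * ((b.val : ℝ) * |ω₀|) := by ring
          _ ≤ γ * (ε / (3 * γ)) := this
          _ = ε / 3 := by field_simp
      have f3 : |(((N : ℝ) - 1) - b.val) * γ * ω₁| ≤ ε / 3 := by
        rw [abs_mul, abs_mul, abs_of_nonneg hNb, abs_of_pos hγ]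
        have : γ * ((((N : ℝ) - 1) - b.val) * |ω₁|) ≤ γ * (ε / (3 * γ)) := by gcongr
        calc (((N : ℝ) - 1) - b.val) * γ * |ω₁| = γ * ((((N : ℝ) - 1) - b.val) * |ω₁|) := by ring
          _ ≤ γ * (ε / (3 * γ)) := this
          _ = ε / 3 := by field_simp
      calc |r - (b.val : ℝ) * γ * ω₀ + (((N : ℝ) - 1) - b.val) * γ * ω₁ - k|
          = |(r - k) + (-((b.val : ℝ) * γ * ω₀)) + (((N : ℝ) - 1) - b.val) * γ * ω₁| := by ring_nf
        _ ≤ |r - k| + |(-((b.val : ℝ) * γ * ω₀))| + |(((N : ℝ) - 1) - b.val) * γ * ω₁| := abs_add_three _ _ _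
        _ ≤ ε / 3 + ε / 3 + ε / 3 := by rw [abs_neg]; gcongr
        _ = ε := by ring
  · -- contact clause: verbatim from (R4)
    obtain ⟨w, hw, hwC⟩ := hC₄ N hN b hb
    exact ⟨w, hw, hwC.trans (le_max_right _ _)⟩

/-- Card B, second checkable statement (WARD IDENTITY / elimination of the clamped dynamics from the
bulk block): the vertex-memory matrix `[schur_s(ΘLe_x, Le_y)]_{xy}` equals
`s·χ + Γ_b − χ G(s)⁻¹ χ` exactly (`χ = cov(e,e)`, `Γ_b = γT²(δ₀δ₀ᵀ + δ_{N−1}δ_{N−1}ᵀ)`); its bulk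
block is `−(Dᵀ 𝔎_N(s) D)` with `𝔎_N(s)_{bb'} = schur_s(j_b, j_{b'})`, so the symmetric memory
matrix `𝔎_N(s)` is determined by the inverse energy structure factor `G(s)⁻¹` and contact terms. -/
def WardIdentity : Prop :=
  ∀ ω₂ lam β γ : ℝ, 0 < ω₂ → 0 < lam → 0 < β → 0 < γ → ∀ T : ℝ, 0 < T → ∀ N : ℕ, 2 ≤ N →
    let P := Literature.MathematicalPhysics.KineticTheory.HeatConduction.pinnedChain ω₂ lam β γ
    let X := Literature.MathematicalPhysics.KineticTheory.HeatConduction.PhaseSpace N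
    let μ : Measure X := P.gibbsMeasure N T
    let corr : (X → ℝ) → (X → ℝ) → ℝ → ℝ := fun f g t =>
      (∫ z, f z * (∫ y, g y ∂(P.transitionKernel N T T t.toNNReal z)) ∂μ) - (∫ z, f z ∂μ) * (∫ z, g z ∂μ)
    let lap : ℝ → (X → ℝ) → (X → ℝ) → ℝ := fun s f g =>
      ∫ t in Set.Ioi (0 : ℝ), Real.exp (-(s * t)) * corr f g t
    let cov : (X → ℝ) → (X → ℝ) → ℝ := fun f g => (∫ z, f z * g z ∂μ) - (∫ z, f z ∂μ) * (∫ z, g z ∂μ)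
    let e : Fin N → X → ℝ := fun x z => z.2 x ^ 2 / 2 + P.U (z.1 x) +
      ∑ j : Fin N, ((if j.val = x.val + 1 then P.V (z.1 j - z.1 x) / 2 else 0) +
        (if x.val = j.val + 1 then P.V (z.1 x - z.1 j) / 2 else 0))
    let G : ℝ → Matrix (Fin N) (Fin N) ℝ := fun s => Matrix.of fun x y => lap s (e x) (e y)
    let χ : Matrix (Fin N) (Fin N) ℝ := Matrix.of fun x y => cov (e x) (e y)
    let schur : ℝ → (X → ℝ) → (X → ℝ) → ℝ := fun s f g =>
      lap s f g - ∑ x : Fin N, ∑ y : Fin N, lap s f (e x) * (G s)⁻¹ x y * lap s (e y) g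
    ∀ s : ℝ, 0 < s → ∀ x y : Fin N,
      schur s (fun z => P.generator N T T (e x) (z.1, -z.2)) (P.generator N T T (e y)) =
        s * χ x y + (if x = y ∧ (x.val = 0 ∨ x.val = N - 1) then P.γ * T ^ 2 else 0) -
          (χ * (G s)⁻¹ * χ) x y

end Summit.AtomisticToContinuum.FouriersLaw.Cruxes.OrthogonalOhm.Ideator3
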